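import Summits.CriticalPhenomena.PercolationContinuityZ3.Theorems.PercNearOneGluingNoHeavyLowerTailSahiCTCC2Crossed
import Summits.CriticalPhenomena.PercolationContinuityZ3.Theorems.PercNearOneGluingNoHeavyLowerTailSahiCTCC2LevelTwoVertex
import Summits.CriticalPhenomena.PercolationContinuityZ3.Theorems.PercNearOneGluingNoHeavyLowerTailSahiCTCRtLumped
import HarnessLib

/-!
# `NoHeavyLowerTail` (crux stmt-CriticalPhenomena-4575), P3 lane: C2 HOLDS AT EVERY COMMON-LOOP VERTEX, FOR EVERY LEVEL `t` —
# at a vertex `v` with `{v} ∈ 𝒳 ∩ 𝒵` the C2 difference of `R_t` is `Θ'_{<t−1}·Π'·GF({S : v ∉ S, #S ≥ t, S ∉ 𝒳, S ∉ 𝒵})`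

Support file (seat `prim-l12-p3`, gen 42; `--supports stmt-CriticalPhenomena-4575`).  Memo
`run/shared/lean/prim/prim-l12/FROM-prim-l12-p3-g42-C2-LEVEL-TWO.md` §3.4.  The `t = 2` case is `…SahiCTCC2LevelTwoVertex.RlumpVx_two_sub_three_loops`; here the
same inclusion–exclusion runs at every level through the crossed form of `…SahiCTCC2Crossed`: for up-sets `𝒳, 𝒵`, a vertex `v` that is a loop of both
(`{v} ∈ 𝒳`, `{v} ∈ 𝒵`) and `D = {S : #S < t}`,
    `RlumpVx D 𝒳 𝒵 v 2 − RlumpVx D 𝒳 𝒵 v 3 = GF(linkV v D) · Π' · GF({S : v ∉ S, #S ≥ t, S ∉ 𝒳, S ∉ 𝒵})`       (`RlumpVx_two_sub_three_commonLoop`)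
(`GF(linkV v D) = Θ'_{<t−1}`, `Π' = GF(sets avoiding v)`), which is manifestly `∈ ℕ[s]`; hence **`C2_at_commonLoop`**: for every `t`, every profile `m` with `m_v = 2`,
`coeff_{m+e_v} R_t(𝒳,𝒵) ≤ coeff_m R_t(𝒳,𝒵)` whenever `v` is a common loop (lab check: 1 060 exact cases, all `t`, `n ≤ 5`).  Nothing is asserted about the crux;
C2 at vertices that are not common loops is open for `t ≥ 3`.
-/

noncomputable section

open scoped Classical

namespace Summit.CriticalPhenomena.PercolationContinuityZ3.Theorems.SahiCTCForms

open Finset MvPolynomial SahiCTCGenFun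

variable {α : Type*} [DecidableEq α] [Fintype α]

variable {F G : Finset (Finset α)} {v : α}

/-- **The C2 difference of `R_t` at a common-loop vertex** (`{v} ∈ 𝒳 ∩ 𝒵`), every `t`:
`P₂ − P₃ = GF(linkV v D)·Π'·GF({S : v ∉ S, S ∉ D, S ∉ 𝒳, S ∉ 𝒵})`, `D = {#S < t}`. [this work] -/
theorem RlumpVx_two_sub_three_commonLoop (t : ℕ) (hF : IsUpperSet (F : Set (Finset α))) (hG : IsUpperSet (G : Set (Finset α)))
    (hvF : ({v} : Finset α) ∈ F) (hvG : ({v} : Finset α) ∈ G) :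
    RlumpVx (bySize (· < t)) F G v 2 - RlumpVx (bySize (· < t)) F G v 3 =
      gf (linkV v (bySize (· < t) : Finset (Finset α))) * gf (delV v (univ.powerset : Finset (Finset α)))
        * gf (((delV v (univ.powerset : Finset (Finset α))).filter fun S => S ∉ (bySize (· < t) : Finset (Finset α))).filter
            fun S => S ∉ F ∧ S ∉ G) := by
  obtain ⟨U', hU'⟩ : ∃ U' : Finset (Finset α), U' = delV v (univ.powerset : Finset (Finset α)) := ⟨_, rfl⟩
  obtain ⟨PD, hPD⟩ : ∃ PD : Finset (Finset α), PD = U'.filter fun S => S ∉ (bySize (· < t) : Finset (Finset α)) := ⟨_, rfl⟩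
  obtain ⟨LD, hLD⟩ : ∃ LD : Finset (Finset α), LD = linkV v (bySize (· < t) : Finset (Finset α)) := ⟨_, rfl⟩
  have hmemU' : ∀ S : Finset α, S ∈ U' ↔ v ∉ S := fun S => by
    rw [hU']; simp only [delV, mem_filter, mem_powerset, subset_univ, true_and]
  have hmemLD : ∀ S : Finset α, S ∈ LD ↔ v ∉ S ∧ insert v S ∈ (bySize (· < t) : Finset (Finset α)) := fun S => by
    rw [hLD]; simp only [linkV, mem_filter, mem_powerset, subset_erase, subset_univ, true_and]
  have hxF : gf (linkV v F) = gf U' := by rw [hU', linkV_eq_delV_powerset F v hF hvF]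
  have hxG : gf (linkV v G) = gf U' := by rw [hU', linkV_eq_delV_powerset G v hG hvG]
  have hpF : linkV v (F.filter fun S => S ∈ (bySize (· < t) : Finset (Finset α))) = LD := by
    rw [linkV_filter, linkV_eq_delV_powerset F v hF hvF]
    ext S; rw [mem_filter, hmemLD, ← hU', hmemU']
  have hpG : linkV v (G.filter fun S => S ∈ (bySize (· < t) : Finset (Finset α))) = LD := by
    rw [linkV_filter, linkV_eq_delV_powerset G v hG hvG]
    ext S; rw [mem_filter, hmemLD, ← hU', hmemU']
  have hc' : gf (linkV v ((F ∩ G).filter fun S => S ∉ (bySize (· < t) : Finset (Finset α)))) = gf U' - gf LD := by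
    rw [linkV_filter, linkV_inter, linkV_eq_delV_powerset F v hF hvF, linkV_eq_delV_powerset G v hG hvG, inter_self, ← hU',
      eq_sub_iff_add_eq]
    have hsplit := gf_filter_add_gf_filter_not U' (fun S => insert v S ∉ (bySize (· < t) : Finset (Finset α)))
    have hrest : U'.filter (fun S => ¬ insert v S ∉ (bySize (· < t) : Finset (Finset α))) = LD := by
      ext S; rw [mem_filter, not_not, hmemLD, hmemU']
    rw [hrest] at hsplit
    exact hsplit
  have ha : gf (delV v (bySize (· < t) : Finset (Finset α))) = gf U' - gf PD := by
    have : delV v (bySize (· < t) : Finset (Finset α)) = U'.filter fun S => ¬ S ∉ (bySize (· < t) : Finset (Finset α)) := by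
      ext S; simp only [delV, bySize, mem_filter, mem_powerset, subset_univ, true_and, hmemU', not_not]; tauto
    rw [this, eq_sub_iff_add_eq, hPD, add_comm, gf_filter_add_gf_filter_not]
  have hdelF : delV v F = U'.filter fun S => S ∈ F := by ext S; simp only [delV, mem_filter, hmemU']; tauto
  have hdelG : delV v G = U'.filter fun S => S ∈ G := by ext S; simp only [delV, mem_filter, hmemU']; tauto
  have hp : gf (delV v (F.filter fun S => S ∈ (bySize (· < t) : Finset (Finset α))))
      = gf (delV v F) - gf (PD.filter fun S => S ∈ F) := by
    rw [delV_filter, eq_sub_iff_add_eq, hPD, Finset.filter_comm, ← hdelF, gf_filter_add_gf_filter_not]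
  have hq : gf (delV v (G.filter fun S => S ∈ (bySize (· < t) : Finset (Finset α))))
      = gf (delV v G) - gf (PD.filter fun S => S ∈ G) := by
    rw [delV_filter, eq_sub_iff_add_eq, hPD, Finset.filter_comm, ← hdelG, gf_filter_add_gf_filter_not]
  have hc : gf (delV v ((F ∩ G).filter fun S => S ∉ (bySize (· < t) : Finset (Finset α))))
      = gf ((PD.filter fun S => S ∈ F).filter fun S => S ∈ G) := by
    rw [delV_filter, hPD]
    congr 1; ext S; simp only [delV, mem_filter, mem_inter, hmemU']; tauto
  have s1 := gf_filter_add_gf_filter_not PD (fun S => S ∈ F)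
  have s3 := gf_filter_add_gf_filter_not (PD.filter fun S => ¬ S ∈ F) (fun S => S ∈ G)
  have s4 := gf_filter_add_gf_filter_not (PD.filter fun S => S ∈ G) (fun S => S ∈ F)
  rw [Finset.filter_comm] at s4
  have e2 : (PD.filter fun S => S ∈ G).filter (fun S => ¬ S ∈ F) = (PD.filter fun S => ¬ S ∈ F).filter fun S => S ∈ G :=
    Finset.filter_comm _ _ _
  rw [e2] at s4
  have hN : gf (PD.filter fun S => S ∉ F ∧ S ∉ G) = gf (PD.filter fun S => ¬ S ∈ F) - gf ((PD.filter fun S => ¬ S ∈ F).filter fun S => S ∈ G) := by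
    rw [eq_sub_iff_add_eq, add_comm, ← Finset.filter_filter, s3]
  rw [RlumpVx_two_sub_three_eq_crossed, hxF, hxG, hpF, hpG, hc', ha, hp, hq, hc, ← hLD, ← hU', ← hPD, hN]
  linear_combination (-(gf LD * gf U')) * s1 + (gf LD * gf U') * s4

/-- **C2 at a common-loop vertex, every level `t`**: for up-sets `𝒳, 𝒵`, a vertex `v` with `{v} ∈ 𝒳 ∩ 𝒵`, and every profile `m` with `m_v = 2`,
`coeff_{m + e_v} R_t(𝒳,𝒵) ≤ coeff_m R_t(𝒳,𝒵)`. [this work] -/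
theorem C2_at_commonLoop (t : ℕ) (hF : IsUpperSet (F : Set (Finset α))) (hG : IsUpperSet (G : Set (Finset α)))
    (hvF : ({v} : Finset α) ∈ F) (hvG : ({v} : Finset α) ∈ G) (m : α →₀ ℕ) (hv : m v = 2) :
    (Rt t F G).coeff (m + Finsupp.single v 1) ≤ (Rt t F G).coeff m := by
  set m₀ := m - Finsupp.single v 2 with hm₀
  have hm₀v : m₀ v = 0 := by rw [hm₀, Finsupp.tsub_apply, Finsupp.single_eq_same, hv]
  have hm_eq : m = m₀ + Finsupp.single v 2 := by
    rw [hm₀, tsub_add_cancel_of_le]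
    rw [Finsupp.single_le_iff, hv]
  have h3 : m + Finsupp.single v 1 = m₀ + Finsupp.single v 3 := by
    rw [hm_eq, add_assoc, ← Finsupp.single_add]
  rw [h3, hm_eq, Rt_eq_Rlump, coeff_Rlump_add_single _ F G v hm₀v (by norm_num),
    coeff_Rlump_add_single _ F G v hm₀v (by norm_num), ← sub_nonneg, ← coeff_sub, RlumpVx_two_sub_three_commonLoop t hF hG hvF hvG]
  exact coeff_mul_nonneg (coeff_mul_nonneg (coeff_gf_nonneg _) (coeff_gf_nonneg _)) (coeff_gf_nonneg _) m₀

end Summit.CriticalPhenomena.PercolationContinuityZ3.Theorems.SahiCTCForms
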